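import Summits.QuantumFields.BalabanUV.T4Continuum.Support.VariationalColourTaxiTowerStep
import Summits.QuantumFields.BalabanUV.T4Continuum.Support.VariationalVectorTaxiUpperBound
import Summits.QuantumFields.BalabanUV.T4Continuum.Support.VariationalVectorPoincareNear

/-!
# T⁴ programme, spine node NE2 (U1a), lane P2 — «V-COL-TAXI-TOWER», part 5: THE COARSE-LEVEL LEAVES `hUBc` ∕ `hPc` (transport side) OF THE VECTOR END AT BAŁABAN's
# TAXI DATA ALONG THE TOWER — leaf-03-g4's frame-relative V-UB-L and leaf-10-g3's near-product V-P at `(n, M) := (L^k, M)` for the NESTED carriers `nestLv k`,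
# frames ∕ site transports the STRAIGHT level-`k` taxi, `hT` ∕ `hnear` := (E_k), `hw` := the straight taxi's in-block defect; NO gauge condition, k-UNIFORM sizes

NE2 formalisation swarm `b2b-balaban-t4-ne2-formalise-*`, leaf prover 04 GEN 4 (`prover-b2b-balaban-t4-ne2-formalise-leaf-04-g4-0`); register row «P2-sup» of
`t4/formal/NE2/LEAVES.md`; journal CLAIMS.log «V-COL-TAXI-TOWER».  Compositions BY NAME of leaf-03-g4's `VectorBlockTrialForm.exists_ubV_nearFrame_ScV` (p220640) and
leaf-10-g3's `VariationalVectorPoincareNear.qWV_le_near_line_poincare` (p219305) with part 4's `nestLv_sub_lineT_le` ((E_k)), «V-COL-TAXI» part 4's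
`lineT_sub_frameT_taxi_le` (p221066) and part 2's `inBlock_defect_taxiTv_adjoint_le` (p219787), all at the level-`k` data `(L^k, M, Rlev k)` (unitary by `Rlev_mem_unitary`).
 * §1 **`inBlock_blockOf_of_bpt`** (the carry identity inlined; it coincides with `DirichletMonotoneCutoff.bpt_add_unitVec_of_eq` of the resolvent lineage,
   whose module is not imported here — unrelated closure): the BASE-POINT form of an in-block bond hypothesis (`(j μ)+1 < n`) gives the BLOCK form (`blockOf (x + e_μ) = blockOf x`) once
   `1 < M_μ` for all `μ` — on a unit torus of side `1` the block form also quantifies over the wrap-around bond, whose defect at taxi data is a NON-contractible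
   holonomy and is NOT small (HONEST: the conversion genuinely needs `1 < M_μ`; the tree's V-P files state the block form).
 * §1b `sites_add_unitVec`, **`Rlev_plaq_succ`** ∕ **`Rlev_plaq_zero`**: the level-`k` plaquette defects from the one-step ones — `a_{k+1} = b_k` (re-indexing through `sites`),
   `a_0 ≤ L²·b_0` (`coarseTv_plaq_le`); so the displayed `a_k` below is discharged by the END's user in one line per level.
 * §2 **`exists_ubV_nestLv_ScV`** (`hUBc k`): along a COHERENT tower of UNITARY one-step bond operators with one-step plaquette defects `b_q` and level-`k` plaquette
   defect `a_k`, with `γ_k := Σ_{q<k} ((d−1)+d²)·L(L^q−1)(L−1)·b_q + 3(d−1)L^k(L^k−1)a_k` and the ONE smallness `κ_{L^k}⁻¹·γ_k < 1`, (GF1′) for `G`: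
   `∀ φ, ∃ W, QvL (L^k) M (nestLv k) W = φ ∧ ScV (L^k) M (Rlev k) G W ≤ lamV d (L^k·(d−1)(L^k−1)a_k) C_G ((L^k)²C₀) ∕ (1 − κ⁻¹γ_k)² · nsqV M φ`.
 * §3 **`qWV_le_nestLv`** (`hPc k`, transport side): `2d·(L^k·(d−1)(L^k−1)a_k)² ≤ ½`, `64·(Σ_{q<k} …·b_q)² ≤ 1`, `1 < M_μ` ⟹
   `qWV (L^k) M W ≤ 64·nsqV M (QvL (L^k) M (nestLv k) W) + 40·((L^k)^{−d}·((L^k)²·roughV (L^k) M (Rlev k) W))` — leaf-10-g3's `qWV_le_of_garding_near` then turns a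
   displayed Gårding inequality (V-GF's business) into the END's `hPc k`: **`qWV_le_nestLv_of_garding`** (`C_P k = max(40κ, 64 + 40κ′)`, the END's letter).
Sizes under the scale-invariant class `(L^{q+1})²b_q ≤ c`, `(L^k)²a_k ≤ c`: `L^k·w_k ≤ (d−1)c`, `γ_k ≤ (2d²·Σ_q L^{−q} + 3(d−1))·c` — k-UNIFORM; every smallness is a
condition on the field-strength class constant `c`, none on the gauge.
WHAT IS NOT HERE (stated, not hidden): the Gårding half and the `G`-halves (V-GF); V-REG; the END.

HONEST FRAMING (T4-DAG p. 1).  Instantiation at MODEL level (unitary bond operators DATA; taxi ∕ straight contours OURS; SHAPES only, no B0, c5); nothing printed is a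
hypothesis; no `def`, no `def … : Prop`, no `sorry`; axioms standard.  NE2 NOT proved on either road; NE3 OPEN; spine PROVED 0∕9 unchanged; rung (B)+1 finite T⁴ — NOT
infinite volume, NOT mass gap, NOT Clay.  HONEST DEPENDENCY (cell, verbatim): continuum YM on T⁴ ⇐ BetaPertH ∧ nine spine estimates (0/9 proved); BetaPertH ⇐ (D1) ∧ (D4) ∧
CAP+tail; G-an2-4 gates asym, D1 and NE2/3/4.
-/

noncomputable section

namespace Summit.QuantumFields.BalabanUV.T4Continuum.VariationalColourTaxiTransport

open Literature.MathematicalPhysics.QuantumFieldTheory.Balaban1983to89.B5Prop11Plancherel (Tor fine unitVec)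
open Literature.MathematicalPhysics.QuantumFieldTheory.Balaban1983to89.B5Block118 (tstep tstep_zero tstep_succ bpt)
open Literature.MathematicalPhysics.QuantumFieldTheory.Balaban1983to89
open Literature.MathematicalPhysics.QuantumFieldTheory.Balaban1983to89.B5Blocks16 (blockOf blockOf_bpt bpt_bijective)
open Literature.MathematicalPhysics.QuantumFieldTheory.Balaban1983to89.B5Composition116 (sites)
open Summit.QuantumFields.BalabanUV.T4Continuum.VariationalColourFederbush (norm_le_one_of_mem_unitary)
open Summit.QuantumFields.BalabanUV.T4Continuum.VariationalColourTower (Rtrv)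
open Summit.QuantumFields.BalabanUV.T4Continuum.VariationalVectorFederbush (lineT)
open Summit.QuantumFields.BalabanUV.T4Continuum.VariationalVectorInterpolant (frameT)
open Summit.QuantumFields.BalabanUV.T4Continuum.VectorBlockTrialForm (nsqV QvL roughV kappaV exists_ubV_nearFrame_ScV)
open Summit.QuantumFields.BalabanUV.T4Continuum.VariationalVectorForm (ScV qWV lamV)
open Summit.QuantumFields.BalabanUV.T4Continuum.VariationalVectorPoincareNear (qWV_le_near_line_poincare)

variable {d : ℕ}

/-! ## §1 Base-point form ⟹ block form of an in-block bond hypothesis (no wrap-around) -/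

section Block

variable {E : Type*} [NormedAddCommGroup E] [InnerProductSpace ℂ E] [CompleteSpace E]
variable (n : ℕ) [NeZero n] (M : Fin d → ℕ) [hM : ∀ μ, NeZero (M μ)]

/-- **BASE-POINT FORM ⟹ BLOCK FORM** (no wrap-around, `1 < M_μ`): if every bond `(n·y+j, n·y+j+e_μ)` with `j_μ + 1 < n` satisfies `P`, then every bond with both ends
in one block does. [folklore] -/
theorem inBlock_blockOf_of_bpt (hM2 : ∀ μ, 1 < M μ) {P : Tor (fine n M) → Fin d → Prop}
    (hP : ∀ (y : Tor M) (j : Fin d → Fin n) (μ : Fin d), (j μ : ℕ) + 1 < n → P (bpt n M y j) μ)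
    (x : Tor (fine n M)) (μ : Fin d) (hx : blockOf n M (x + unitVec (fine n M) μ) = blockOf n M x) : P x μ := by
  obtain ⟨⟨y, j⟩, rfl⟩ := (bpt_bijective n M).2 x
  by_cases h : (j μ : ℕ) + 1 < n
  · exact hP y j μ h
  · exfalso
    have hj : (j μ : ℕ) + 1 = n := by have := (j μ).is_lt; omega
    -- the bond CARRIES: its far end is `n·(y + e_μ) + (j with j_μ := 0)` (cf. `DirichletMonotoneCutoff.bpt_add_unitVec_of_eq`, not imported: unrelated closure)
    have hcarry : bpt n M y j + unitVec (fine n M) μ = bpt n M (y + unitVec M μ) (Function.update j μ 0) := by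
      have h1 : unitVec M μ = tstep M μ 1 := by rw [tstep_succ, tstep_zero, zero_add]
      rw [h1, bpt_add_tstep_mul n M y (Function.update j μ 0) μ 1, Nat.mul_one, bpt_eq_update_zero_add n M y j μ, add_assoc, ← tstep_succ, hj]
    have hc : blockOf n M (bpt n M y j + unitVec (fine n M) μ) = y + unitVec M μ := by
      rw [hcarry, blockOf_bpt]
    simp only [hc, blockOf_bpt, add_eq_left] at hx
    have h1 := congr_fun hx μ
    haveI : Fact (1 < M μ) := ⟨hM2 μ⟩
    simp [unitVec] at h1

end Block

/-! ## §1b The level-`k` plaquette defects from the one-step ones -/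

section Plaq

variable {E : Type*} [NormedAddCommGroup E] [NormedSpace ℂ E]
variable (L : ℕ) [NeZero L] (M : Fin d → ℕ) [hM : ∀ μ, NeZero (M μ)]

/-- `sites` moves unit vectors to unit vectors: `sites (x + e_κ) = sites x + e_κ`. [folklore] -/
theorem sites_add_unitVec (n : ℕ) [NeZero n] (x : Tor (fine (n * L) M)) (κ : Fin d) :
    sites n L M (x + unitVec (fine (n * L) M) κ) = sites n L M x + unitVec (fine L (fine n M)) κ := by
  obtain ⟨⟨y, J⟩, rfl⟩ := (bpt_bijective (n * L) M).2 x
  obtain ⟨⟨j₂, j₁⟩, rfl⟩ := (B5Composition116.JEquiv n L).surjective J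
  rw [B5Composition116.JEquiv_apply]
  have h1 := B5Composition116.bpt_bpt_tstep n L M y j₂ j₁ κ 0 1
  have h0 := B5Composition116.bpt_bpt_tstep n L M y j₂ j₁ κ 0 0
  simp only [tstep_zero, add_zero, Nat.mul_zero] at h1 h0
  rw [show unitVec (fine (n * L) M) κ = tstep (fine (n * L) M) κ 1 by rw [tstep_succ, tstep_zero, zero_add],
    show unitVec (fine L (fine n M)) κ = tstep (fine L (fine n M)) κ 1 by rw [tstep_succ, tstep_zero, zero_add], ← h1, ← h0]

variable {R' : (k : ℕ) → Tor (fine L (fine (L ^ k) M)) → Fin d → (E →L[ℂ] E)} {b : ℕ → ℝ}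
  (hb : ∀ k x κ ι, ‖R' k x κ * R' k (x + unitVec (fine L (fine (L ^ k) M)) κ) ι - R' k x ι * R' k (x + unitVec (fine L (fine (L ^ k) M)) ι) κ‖ ≤ b k)
include hb

/-- the level-`k+1` bonds `Rlev (k+1) = Rtrv (R′ k)` have the ONE-STEP plaquette defect `b_k` (re-indexing through `sites`). [folklore] -/
theorem Rlev_plaq_succ (k : ℕ) (x : Tor (fine (L ^ (k + 1)) M)) (κ ι : Fin d) :
    ‖Rlev L M R' (k + 1) x κ * Rlev L M R' (k + 1) (x + unitVec (fine (L ^ (k + 1)) M) κ) ι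
        - Rlev L M R' (k + 1) x ι * Rlev L M R' (k + 1) (x + unitVec (fine (L ^ (k + 1)) M) ι) κ‖ ≤ b k := by
  have e : ∀ ν : Fin d, sites (L ^ k) L M (x + unitVec (fine (L ^ (k + 1)) M) ν) = sites (L ^ k) L M x + unitVec (fine L (fine (L ^ k) M)) ν :=
    fun ν => sites_add_unitVec L M (L ^ k) x ν
  show ‖R' k (sites (L ^ k) L M x) κ * R' k (sites (L ^ k) L M (x + unitVec (fine (L ^ (k + 1)) M) κ)) ι
      - R' k (sites (L ^ k) L M x) ι * R' k (sites (L ^ k) L M (x + unitVec (fine (L ^ (k + 1)) M) ι)) κ‖ ≤ b k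
  rw [e κ, e ι]
  exact hb k _ κ ι

omit hM in
/-- the level-`0` bonds (the straight coarsening of `R′ 0`) have plaquette defect `L²·b_0` (part 2's `coarseTv_plaq_le`). [folklore] -/
theorem Rlev_plaq_zero (hR0 : ∀ x μ, ‖R' 0 x μ‖ ≤ 1) (x : Tor (fine (L ^ 0) M)) (κ ι : Fin d) :
    ‖Rlev L M R' 0 x κ * Rlev L M R' 0 (x + unitVec (fine (L ^ 0) M) κ) ι - Rlev L M R' 0 x ι * Rlev L M R' 0 (x + unitVec (fine (L ^ 0) M) ι) κ‖
      ≤ (L : ℝ) * L * b 0 :=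
  coarseTv_plaq_le L (fine (L ^ 0) M) hR0 (hb 0) x κ ι

end Plaq

variable {H : Type*} [NormedAddCommGroup H] [InnerProductSpace ℂ H] [CompleteSpace H] [FiniteDimensional ℂ H]
variable (L : ℕ) [NeZero L] (M : Fin d → ℕ) [hM : ∀ μ, NeZero (M μ)]

/-! ## §2 The coarse-level leaf V-UB along the tower -/

/-- **THE COARSE-LEVEL LEAF V-UB AT BAŁABAN's TAXI DATA ALONG THE TOWER** (`hUBc k` of the vector END): carriers `QvL (L^k) M (nestLv k)`, form `ScV (L^k) M (Rlev k) G`,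
frames the straight level-`k` taxi; binders: unitarity, coherence, the plaquette defects, (GF1′) and the ONE smallness `κ⁻¹γ_k < 1`; NO gauge condition. [folklore] -/
theorem exists_ubV_nestLv_ScV {R' : (k : ℕ) → Tor (fine L (fine (L ^ k) M)) → Fin d → (H →L[ℂ] H)} (hU : ∀ k x μ, R' k x μ ∈ unitary (H →L[ℂ] H))
    {b : ℕ → ℝ} (hb : ∀ k x κ ι, ‖R' k x κ * R' k (x + unitVec (fine L (fine (L ^ k) M)) κ) ι - R' k x ι * R' k (x + unitVec (fine L (fine (L ^ k) M)) ι) κ‖ ≤ b k)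
    (hcoh : ∀ k, coarseTv L (fine (L ^ (k + 1)) M) (R' (k + 1)) = Rtrv (L ^ k) L M (R' k))
    (k : ℕ) {a : ℝ} (ha0 : 0 ≤ a)
    (ha : ∀ x κ ι, ‖Rlev L M R' k x κ * Rlev L M R' k (x + unitVec (fine (L ^ k) M) κ) ι - Rlev L M R' k x ι * Rlev L M R' k (x + unitVec (fine (L ^ k) M) ι) κ‖ ≤ a)
    (hd : 1 ≤ d)
    (hc : (kappaV d (L ^ k))⁻¹ * ((∑ q ∈ Finset.range k, ((((d - 1 : ℕ) : ℝ) + (d : ℝ) * d) * (((L : ℝ) * ((L ^ q - 1 : ℕ) : ℝ) * ((L - 1 : ℕ) : ℝ)) * b q)))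
        + 3 * (((d - 1 : ℕ) : ℝ) * (L ^ k : ℕ) * ((L ^ k - 1 : ℕ) : ℝ) * a)) < 1)
    {G : (Tor (fine (L ^ k) M) → Fin d → H) → ℝ} {CG C₀ : ℝ} (hCG : 0 ≤ CG) (hC₀ : 0 ≤ C₀)
    (hG : ∀ W, G W ≤ CG * roughV (L ^ k) M (Rlev L M R' k) W + C₀ * nsqV (fine (L ^ k) M) W) :
    ∀ φ : Tor M → Fin d → H, ∃ W : Tor (fine (L ^ k) M) → Fin d → H, QvL (L ^ k) M (nestLv L M R' k) W = φ ∧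
      ScV (L ^ k) M (Rlev L M R' k) G W
        ≤ lamV d ((L ^ k : ℕ) * (((d - 1 : ℕ) : ℝ) * ((L ^ k - 1 : ℕ) : ℝ) * a)) CG (((L ^ k : ℕ) : ℝ) ^ 2 * C₀)
          / (1 - (kappaV d (L ^ k))⁻¹ * ((∑ q ∈ Finset.range k, ((((d - 1 : ℕ) : ℝ) + (d : ℝ) * d) * (((L : ℝ) * ((L ^ q - 1 : ℕ) : ℝ) * ((L - 1 : ℕ) : ℝ)) * b q)))
              + 3 * (((d - 1 : ℕ) : ℝ) * (L ^ k : ℕ) * ((L ^ k - 1 : ℕ) : ℝ) * a))) ^ 2 * nsqV M φ := by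
  have hR' : ∀ k x μ, ‖R' k x μ‖ ≤ 1 := fun k x μ => norm_le_one_of_mem_unitary (hU k x μ)
  have hUk : ∀ x μ, Rlev L M R' k x μ ∈ unitary (H →L[ℂ] H) := Rlev_mem_unitary L M hU k
  have hRk : ∀ x μ, ‖Rlev L M R' k x μ‖ ≤ 1 := fun x μ => norm_le_one_of_mem_unitary (hUk x μ)
  have hT : ∀ y j t μ, ‖nestLv L M R' k y j t μ - frameT (L ^ k) M (taxiTv (L ^ k) M (Rlev L M R' k)) (coarseTv (L ^ k) M (Rlev L M R' k)) y j t μ‖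
      ≤ (∑ q ∈ Finset.range k, ((((d - 1 : ℕ) : ℝ) + (d : ℝ) * d) * (((L : ℝ) * ((L ^ q - 1 : ℕ) : ℝ) * ((L - 1 : ℕ) : ℝ)) * b q)))
        + 3 * (((d - 1 : ℕ) : ℝ) * (L ^ k : ℕ) * ((L ^ k - 1 : ℕ) : ℝ) * a) := fun y j t μ =>
    (norm_sub_le_norm_sub_add_norm_sub _ (lineT (L ^ k) M (taxiTv (L ^ k) M (Rlev L M R' k)) (Rlev L M R' k) y j t μ) _).trans
      (add_le_add (nestLv_sub_lineT_le L M hR' hb hcoh k y j t μ) (lineT_sub_frameT_taxi_le (L ^ k) M hRk ha y j t μ))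
  have h := exists_ubV_nearFrame_ScV (L ^ k) M (U' := taxiTv (L ^ k) M (Rlev L M R' k)) (taxiTv_mem_unitary (L ^ k) M hUk) hT hc hRk
    (w := ((d - 1 : ℕ) : ℝ) * ((L ^ k - 1 : ℕ) : ℝ) * a) (by positivity) (fun y j ν hj => inBlock_defect_taxiTv_adjoint_le (L ^ k) M hUk ha y j ν hj) hd hCG hC₀ hG
  simpa only [Nat.cast_pow] using h

/-! ## §3 The coarse-level leaf V-P core along the tower -/

/-- **THE COARSE-LEVEL LEAF V-P CORE AT BAŁABAN's TAXI DATA ALONG THE TOWER** (`hPc k`, transport side): carriers `QvL (L^k) M (nestLv k)`, site frames the straight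
level-`k` taxi, `hnear` := (E_k), `hw` := the taxi in-block defect in block form; NO gauge condition. [folklore] -/
theorem qWV_le_nestLv {R' : (k : ℕ) → Tor (fine L (fine (L ^ k) M)) → Fin d → (H →L[ℂ] H)} (hU : ∀ k x μ, R' k x μ ∈ unitary (H →L[ℂ] H))
    {b : ℕ → ℝ} (hb : ∀ k x κ ι, ‖R' k x κ * R' k (x + unitVec (fine L (fine (L ^ k) M)) κ) ι - R' k x ι * R' k (x + unitVec (fine L (fine (L ^ k) M)) ι) κ‖ ≤ b k)
    (hcoh : ∀ k, coarseTv L (fine (L ^ (k + 1)) M) (R' (k + 1)) = Rtrv (L ^ k) L M (R' k)) (hM2 : ∀ μ, 1 < M μ)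
    (k : ℕ) {a : ℝ}
    (ha : ∀ x κ ι, ‖Rlev L M R' k x κ * Rlev L M R' k (x + unitVec (fine (L ^ k) M) κ) ι - Rlev L M R' k x ι * Rlev L M R' k (x + unitVec (fine (L ^ k) M) ι) κ‖ ≤ a)
    (hsmall : 2 * (d : ℝ) * ((((L ^ k : ℕ) : ℝ)) * (((d - 1 : ℕ) : ℝ) * ((L ^ k - 1 : ℕ) : ℝ) * a)) ^ 2 ≤ 1 / 2)
    (hγs : 64 * (∑ q ∈ Finset.range k, ((((d - 1 : ℕ) : ℝ) + (d : ℝ) * d) * (((L : ℝ) * ((L ^ q - 1 : ℕ) : ℝ) * ((L - 1 : ℕ) : ℝ)) * b q))) ^ 2 ≤ 1)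
    (W : Tor (fine (L ^ k) M) → Fin d → H) :
    qWV (L ^ k) M W ≤ 64 * nsqV M (QvL (L ^ k) M (nestLv L M R' k) W)
      + 40 * (((((L ^ k : ℕ) : ℝ)) ^ d)⁻¹ * ((((L ^ k : ℕ) : ℝ)) ^ 2 * roughV (L ^ k) M (Rlev L M R' k) W)) := by
  have hR' : ∀ k x μ, ‖R' k x μ‖ ≤ 1 := fun k x μ => norm_le_one_of_mem_unitary (hU k x μ)
  have hUk : ∀ x μ, Rlev L M R' k x μ ∈ unitary (H →L[ℂ] H) := Rlev_mem_unitary L M hU k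
  have hRk : ∀ x μ, ‖Rlev L M R' k x μ‖ ≤ 1 := fun x μ => norm_le_one_of_mem_unitary (hUk x μ)
  have hw := inBlock_blockOf_of_bpt (L ^ k) M hM2
    (P := fun x μ => ‖Rlev L M R' k x μ * star (taxiTv (L ^ k) M (Rlev L M R' k) (x + unitVec (fine (L ^ k) M) μ)) * taxiTv (L ^ k) M (Rlev L M R' k) x - 1‖
      ≤ ((d - 1 : ℕ) : ℝ) * ((L ^ k - 1 : ℕ) : ℝ) * a)
    (fun y j μ hj => inBlock_defect_taxiTv_adjoint_le (L ^ k) M hUk ha y j μ hj)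
  have h := qWV_le_near_line_poincare (L ^ k) M (T' := taxiTv (L ^ k) M (Rlev L M R' k)) (taxiTv_mem_unitary (L ^ k) M hUk) hRk hw
    (by simpa only [Nat.cast_pow] using hsmall) (nestLv_sub_lineT_le L M hR' hb hcoh k) hγs W
  simpa only [Nat.cast_pow] using h

/-- **THE END's `hPc k` AT BAŁABAN's TAXI DATA, MODULO THE GÅRDING HALF**: `qWV_le_nestLv` fed into leaf-10-g3's `qWV_le_of_garding_near` — with a DISPLAYED Gårding
inequality `(L^k)^{−d}((L^k)²·roughV (Rlev k) W) ≤ κ·ScV (L^k) M (Rlev k) G W + κ′·nsqV M (QvL (nestLv k) W)` (V-GF's business, NOT proved here):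
`qWV (L^k) M W ≤ max(40κ, 64 + 40κ′)·(ScV (L^k) M (Rlev k) G W + nsqV M (QvL (L^k) M (nestLv k) W))` — the END's `hPc k` letter with `C_P k = max(40κ, 64 + 40κ′)`. [folklore] -/
theorem qWV_le_nestLv_of_garding {R' : (k : ℕ) → Tor (fine L (fine (L ^ k) M)) → Fin d → (H →L[ℂ] H)} (hU : ∀ k x μ, R' k x μ ∈ unitary (H →L[ℂ] H))
    {b : ℕ → ℝ} (hb : ∀ k x κ ι, ‖R' k x κ * R' k (x + unitVec (fine L (fine (L ^ k) M)) κ) ι - R' k x ι * R' k (x + unitVec (fine L (fine (L ^ k) M)) ι) κ‖ ≤ b k)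
    (hcoh : ∀ k, coarseTv L (fine (L ^ (k + 1)) M) (R' (k + 1)) = Rtrv (L ^ k) L M (R' k)) (hM2 : ∀ μ, 1 < M μ)
    (k : ℕ) {a : ℝ}
    (ha : ∀ x κ ι, ‖Rlev L M R' k x κ * Rlev L M R' k (x + unitVec (fine (L ^ k) M) κ) ι - Rlev L M R' k x ι * Rlev L M R' k (x + unitVec (fine (L ^ k) M) ι) κ‖ ≤ a)
    (hsmall : 2 * (d : ℝ) * ((((L ^ k : ℕ) : ℝ)) * (((d - 1 : ℕ) : ℝ) * ((L ^ k - 1 : ℕ) : ℝ) * a)) ^ 2 ≤ 1 / 2)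
    (hγs : 64 * (∑ q ∈ Finset.range k, ((((d - 1 : ℕ) : ℝ) + (d : ℝ) * d) * (((L : ℝ) * ((L ^ q - 1 : ℕ) : ℝ) * ((L - 1 : ℕ) : ℝ)) * b q))) ^ 2 ≤ 1)
    {G : (Tor (fine (L ^ k) M) → Fin d → H) → ℝ} (hG0 : ∀ W, 0 ≤ G W) {κ κ' : ℝ}
    (hGar : ∀ W, ((((L ^ k : ℕ) : ℝ)) ^ d)⁻¹ * ((((L ^ k : ℕ) : ℝ)) ^ 2 * roughV (L ^ k) M (Rlev L M R' k) W)
      ≤ κ * ScV (L ^ k) M (Rlev L M R' k) G W + κ' * nsqV M (QvL (L ^ k) M (nestLv L M R' k) W))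
    (W : Tor (fine (L ^ k) M) → Fin d → H) :
    qWV (L ^ k) M W ≤ max (40 * κ) (64 + 40 * κ') * (ScV (L ^ k) M (Rlev L M R' k) G W + nsqV M (QvL (L ^ k) M (nestLv L M R' k) W)) := by
  have h := qWV_le_nestLv L M hU hb hcoh hM2 k ha hsmall hγs W
  have hS0 : 0 ≤ ScV (L ^ k) M (Rlev L M R' k) G W := VariationalVectorForm.ScV_nonneg (L ^ k) M _ hG0 W
  have hN0 : 0 ≤ nsqV M (QvL (L ^ k) M (nestLv L M R' k) W) := VectorBlockTrialForm.nsqV_nonneg M _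
  have h1 : 40 * κ ≤ max (40 * κ) (64 + 40 * κ') := le_max_left _ _
  have h2 : 64 + 40 * κ' ≤ max (40 * κ) (64 + 40 * κ') := le_max_right _ _
  calc qWV (L ^ k) M W ≤ 64 * nsqV M (QvL (L ^ k) M (nestLv L M R' k) W)
        + 40 * (((((L ^ k : ℕ) : ℝ)) ^ d)⁻¹ * ((((L ^ k : ℕ) : ℝ)) ^ 2 * roughV (L ^ k) M (Rlev L M R' k) W)) := h
    _ ≤ 64 * nsqV M (QvL (L ^ k) M (nestLv L M R' k) W) + 40 * (κ * ScV (L ^ k) M (Rlev L M R' k) G W + κ' * nsqV M (QvL (L ^ k) M (nestLv L M R' k) W)) := by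
        linarith [hGar W]
    _ = (40 * κ) * ScV (L ^ k) M (Rlev L M R' k) G W + (64 + 40 * κ') * nsqV M (QvL (L ^ k) M (nestLv L M R' k) W) := by ring
    _ ≤ max (40 * κ) (64 + 40 * κ') * ScV (L ^ k) M (Rlev L M R' k) G W + max (40 * κ) (64 + 40 * κ') * nsqV M (QvL (L ^ k) M (nestLv L M R' k) W) :=
        add_le_add (mul_le_mul_of_nonneg_right h1 hS0) (mul_le_mul_of_nonneg_right h2 hN0)
    _ = _ := by ring

end Summit.QuantumFields.BalabanUV.T4Continuum.VariationalColourTaxiTransport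

end
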